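import Literature.MathematicalPhysics.QuantumFieldTheory.YangMillsOS
import Literature.MathematicalPhysics.QuantumFieldTheory.LatticeGaugeProofs
import Literature.MathematicalPhysics.QuantumLattice.ContinuumLimitLGT
import Literature.MathematicalPhysics.QuantumLattice.TorusCubeSeparation
import HarnessLib

/-!
# `HypercubicLimit`, line `conditional-mean-telescoping`: stub `stub_telescoping`

Support file (`--supports stmt-QuantumFields-8646`) for crux
`Summit.QuantumFields.YangMills.Theses.PencilRigidity.HypercubicLimit`, line
`conditional-mean-telescoping`: the registered stub `stub_telescoping` — LOCALITY ⇒ (T) ∧ (M),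
in tree vocabulary (Wilson's measure on the torus of side `2S+1`, the centred plaquette
`Re tr ρ(U_p) − ⟨Re tr ρ(U_p)⟩` read through the periodic lift, the cylinder σ-algebras of the
images under `torusEdge` of the link cubes `Q_R(x)`).

* (T) **telescoping bound**: for plaquettes at base points pairwise separated by more than
  `2R+1` and at most `S` in some coordinate, `4R+4 < 2S+1`,
  `|E ∏ₖ δpₖ| ≤ ∏ₖ ‖E[δpₖ | exterior of Q_R(xₖ)]‖_{Lⁿ}`.  The local versions `gₖ` of the
  conditional means (the hypothesis, = the landed stub `stub_condMeanLocality`) replace the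
  `δpₖ` one at a time (`integral_prod_eq_integral_prod_of_ae_eq_condExp`: tower property and
  pull-out, the other factors being measurable inside cubes `Q_{R+1}(x_l)` whose torus images
  miss the image of `Q_R(xₖ)` — `image_torusEdge_linkCube_succ_subset_compl`), then the
  generalised Hölder inequality with exponents `1/n` (`abs_integral_prod_le_prod_toReal_eLpNorm`).
  The influences are taken AT the base points: no translation invariance is used.
* (M) **antitonicity in the radius**: `Q_{R'} ⊆ Q_R` (`linkCube_mono`), so the exterior
  σ-algebras are antitone; tower property and `Lᵖ`-contractivity
  (`toReal_eLpNorm_condExp_mono`), finiteness from boundedness of the plaquette.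

The general lemmas are `Literature/MathematicalPhysics/QuantumLattice/TorusCubeSeparation.lean`.
-/

noncomputable section

open scoped SchwartzMap ENNReal
open MeasureTheory Filter Topology
open Literature.MathematicalPhysics.AQFT Literature.MathematicalPhysics.QuantumLattice
open Literature.MathematicalPhysics.QuantumFieldTheory

namespace Summit.QuantumFields.YangMills.Cruxes.HypercubicLimit.ConditionalMeanTelescoping

/-! ## (T) for one group, one torus, one radius -/

/-- **(T) from locality**, for one group, one torus and one radius: if every centred plaquette
has a version of its conditional mean given the exterior of `Q_R` that is measurable inside
`Q_{R+1}`, then for base points pairwise separated by more than `2R+1` and at most `S` in some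
coordinate (`4R+4 < 2S+1`), `|E ∏ₖ δpₖ| ≤ ∏ₖ ‖E[δpₖ | exterior of Q_R(xₖ)]‖ₙ` under Wilson's
measure on the torus of side `2S+1` (telescoping through the local versions, then generalised
Hölder; `n = 0` is the trivial `1 ≤ 1`). [folklore] -/
theorem telescoping_core {G : Type} [Group G] [TopologicalSpace G] [IsTopologicalGroup G]
    [CompactSpace G] [MeasurableSpace G] [BorelSpace G] (r : LatticeRep G) (β : ℝ) (S R n : ℕ)
    (o : Fin n → Fin 4 × Fin 4) (x : Fin n → Literature.Probability.LatticeModels.Site 4)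
    (hloc : ∀ (c : Literature.Probability.LatticeModels.Site 4) (i j : Fin 4),
      ∃ g : GaugeConfig 4 (2 * S + 1) G → ℝ,
        StronglyMeasurable[(cylinderEvents
            (torusEdge (2 * S + 1) ''
              {e : Literature.MathematicalPhysics.QuantumLattice.ZdEdge 4 |
                (∀ ν, |e.1 ν - c ν| ≤ ((R + 1 : ℕ) : ℤ)) ∧
                ∀ ν, |e.1 ν + (if ν = e.2 then 1 else 0) - c ν| ≤ ((R + 1 : ℕ) : ℤ)}) :
            MeasurableSpace (GaugeConfig 4 (2 * S + 1) G))] g ∧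
        g =ᵐ[(wilsonMeasure r.ρ β : Measure (GaugeConfig 4 (2 * S + 1) G))]
          (wilsonMeasure r.ρ β : Measure (GaugeConfig 4 (2 * S + 1) G))[fun U =>
              plaquetteObs r.ρ c i j (torusLift (2 * S + 1) U) -
                ∫ V, plaquetteObs r.ρ c i j (torusLift (2 * S + 1) V)
                  ∂(wilsonMeasure r.ρ β : Measure (GaugeConfig 4 (2 * S + 1) G)) |
            (cylinderEvents
              (torusEdge (2 * S + 1) ''
                {e : Literature.MathematicalPhysics.QuantumLattice.ZdEdge 4 |
                  (∀ ν, |e.1 ν - c ν| ≤ R) ∧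
                  ∀ ν, |e.1 ν + (if ν = e.2 then 1 else 0) - c ν| ≤ R})ᶜ :
              MeasurableSpace (GaugeConfig 4 (2 * S + 1) G))])
    (hRS : 4 * R + 4 < 2 * S + 1)
    (hsep : ∀ k l, k ≠ l → ∃ μ : Fin 4, (2 * R + 1 : ℤ) < |x k μ - x l μ| ∧ |x k μ - x l μ| ≤ S) :
    |∫ U, ∏ k, (plaquetteObs r.ρ (x k) (o k).1 (o k).2 (torusLift (2 * S + 1) U) -
          ∫ V, plaquetteObs r.ρ (x k) (o k).1 (o k).2 (torusLift (2 * S + 1) V)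
            ∂(wilsonMeasure r.ρ β : Measure (GaugeConfig 4 (2 * S + 1) G)))
        ∂(wilsonMeasure r.ρ β : Measure (GaugeConfig 4 (2 * S + 1) G))| ≤
      ∏ k, (eLpNorm
        ((wilsonMeasure r.ρ β : Measure (GaugeConfig 4 (2 * S + 1) G))[fun U =>
            plaquetteObs r.ρ (x k) (o k).1 (o k).2 (torusLift (2 * S + 1) U) -
              ∫ V, plaquetteObs r.ρ (x k) (o k).1 (o k).2 (torusLift (2 * S + 1) V)
                ∂(wilsonMeasure r.ρ β : Measure (GaugeConfig 4 (2 * S + 1) G)) |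
          (cylinderEvents
            (torusEdge (2 * S + 1) ''
              {e : Literature.MathematicalPhysics.QuantumLattice.ZdEdge 4 |
                (∀ ν, |e.1 ν - (x k) ν| ≤ R) ∧
                ∀ ν, |e.1 ν + (if ν = e.2 then 1 else 0) - (x k) ν| ≤ R})ᶜ :
            MeasurableSpace (GaugeConfig 4 (2 * S + 1) G))])
        (n : ℝ≥0∞) (wilsonMeasure r.ρ β : Measure (GaugeConfig 4 (2 * S + 1) G))).toReal := by
  haveI : SecondCountableTopology G :=
    (r.continuous.isClosedEmbedding r.injective).isEmbedding.secondCountableTopology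
  haveI := isProbabilityMeasure_wilsonMeasure (d := 4) (L := 2 * S + 1) r.ρ r.continuous β
  rcases Nat.eq_zero_or_pos n with rfl | hn
  · simp
  set μW := (wilsonMeasure r.ρ β : Measure (GaugeConfig 4 (2 * S + 1) G)) with hμW
  choose g hgm hgae using fun k => hloc (x k) (o k).1 (o k).2
  set X : Fin n → GaugeConfig 4 (2 * S + 1) G → ℝ := fun k U =>
    plaquetteObs r.ρ (x k) (o k).1 (o k).2 (torusLift (2 * S + 1) U) -
      ∫ V, plaquetteObs r.ρ (x k) (o k).1 (o k).2 (torusLift (2 * S + 1) V) ∂μW with hX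
  -- telescoping through the local versions `g k`
  have key := integral_prod_eq_integral_prod_of_ae_eq_condExp (μ := μW)
    (fun k => (cylinderEvents (torusEdge (2 * S + 1) ''
      {e : Literature.MathematicalPhysics.QuantumLattice.ZdEdge 4 |
        (∀ ν, |e.1 ν - x k ν| ≤ ((R + 1 : ℕ) : ℤ)) ∧
        ∀ ν, |e.1 ν + (if ν = e.2 then 1 else 0) - x k ν| ≤ ((R + 1 : ℕ) : ℤ)}) :
      MeasurableSpace (GaugeConfig 4 (2 * S + 1) G)))
    (fun k => (cylinderEvents (torusEdge (2 * S + 1) ''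
      {e : Literature.MathematicalPhysics.QuantumLattice.ZdEdge 4 |
        (∀ ν, |e.1 ν - x k ν| ≤ (R : ℤ)) ∧
        ∀ ν, |e.1 ν + (if ν = e.2 then 1 else 0) - x k ν| ≤ (R : ℤ)})ᶜ :
      MeasurableSpace (GaugeConfig 4 (2 * S + 1) G)))
    (fun _ => cylinderEvents_le_pi) (fun _ => cylinderEvents_le_pi)
    (fun k l hkl =>
      cylinderEvents_mono (image_torusEdge_linkCube_succ_subset_compl hRS (hsep k l hkl)))
    (X := X) (g := g) (B := 2 * r.N)
    (fun k => stronglyMeasurable_plaquetteObs_torusLift_sub r.ρ r.continuous _ le_add_self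
      _ _ _ _)
    (fun k U => abs_plaquetteObs_torusLift_sub_integral_le r.ρ r.mem_unitary _ _ _ _ μW U)
    hgm hgae
  -- generalised Hölder for the local versions, which are in `Lⁿ` like the conditional means
  have h1n : (1 : ℝ≥0∞) ≤ n := by exact_mod_cast hn
  have hgmem : ∀ k, MemLp (g k) (n : ℝ≥0∞) μW := fun k =>
    ((memLp_plaquetteObs_torusLift_sub_integral r.ρ r.continuous r.mem_unitary (2 * S + 1)
      (x k) (o k).1 (o k).2 μW n).condExp h1n).ae_eq (hgae k).symm
  calc |∫ U, ∏ k, X k U ∂μW| = |∫ U, ∏ k, g k U ∂μW| := by rw [key]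
    _ ≤ ∏ k, (eLpNorm (g k) (n : ℝ≥0∞) μW).toReal :=
        abs_integral_prod_le_prod_toReal_eLpNorm hn.ne' g hgmem
    _ = _ := Finset.prod_congr rfl fun k _ => by rw [eLpNorm_congr_ae (hgae k)]

/-! ## The registered stub -/

/-- **stub_telescoping** — LOCALITY ⇒ (T) ∧ (M), in tree vocabulary.  (T): for every compact
gauge group with lattice representation data `r`, real `β`, torus half-side `S`, radius `R`,
and `n` plaquettes of orientations `o k` at base points `x k` pairwise separated by more than
`2R+1` and at most `S` in some coordinate (`4R+4 < 2S+1`), the torus `n`-point function of the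
centred plaquettes is bounded by the product of the `Lⁿ` norms of their conditional means given
the exteriors of the cubes `Q_R(x k)` (telescoping through the local versions supplied by the
hypothesis, then generalised Hölder).  (M): these norms are antitone in `R` for `1 ≤ p` (tower
property and `Lᵖ`-contractivity of conditional expectation). [folklore] -/
theorem stub_telescoping :
    (∀ (G : Type) [Group G] [TopologicalSpace G] [IsTopologicalGroup G] [CompactSpace G]
        [MeasurableSpace G] [BorelSpace G] (r : LatticeRep G) (β : ℝ) (S R : ℕ)
        (x : Literature.Probability.LatticeModels.Site 4) (i j : Fin 4),
      ∃ g : GaugeConfig 4 (2 * S + 1) G → ℝ,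
        StronglyMeasurable[(cylinderEvents
            (torusEdge (2 * S + 1) ''
              {e : Literature.MathematicalPhysics.QuantumLattice.ZdEdge 4 |
                (∀ ν, |e.1 ν - x ν| ≤ ((R + 1 : ℕ) : ℤ)) ∧
                ∀ ν, |e.1 ν + (if ν = e.2 then 1 else 0) - x ν| ≤ ((R + 1 : ℕ) : ℤ)}) :
            MeasurableSpace (GaugeConfig 4 (2 * S + 1) G))] g ∧
        g =ᵐ[(wilsonMeasure r.ρ β : Measure (GaugeConfig 4 (2 * S + 1) G))]
          (wilsonMeasure r.ρ β : Measure (GaugeConfig 4 (2 * S + 1) G))[fun U =>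
              plaquetteObs r.ρ x i j (torusLift (2 * S + 1) U) -
                ∫ V, plaquetteObs r.ρ x i j (torusLift (2 * S + 1) V)
                  ∂(wilsonMeasure r.ρ β : Measure (GaugeConfig 4 (2 * S + 1) G)) |
            (cylinderEvents
              (torusEdge (2 * S + 1) ''
                {e : Literature.MathematicalPhysics.QuantumLattice.ZdEdge 4 |
                  (∀ ν, |e.1 ν - x ν| ≤ R) ∧
                  ∀ ν, |e.1 ν + (if ν = e.2 then 1 else 0) - x ν| ≤ R})ᶜ :
              MeasurableSpace (GaugeConfig 4 (2 * S + 1) G))]) →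
    (∀ (G : Type) [Group G] [TopologicalSpace G] [IsTopologicalGroup G] [CompactSpace G]
        [MeasurableSpace G] [BorelSpace G] (r : LatticeRep G) (β : ℝ) (S R n : ℕ)
        (o : Fin n → Fin 4 × Fin 4) (x : Fin n → Literature.Probability.LatticeModels.Site 4),
      (∀ k, (o k).1 ≠ (o k).2) →
      4 * R + 4 < 2 * S + 1 →
      (∀ k l, k ≠ l → ∃ μ : Fin 4, (2 * R + 1 : ℤ) < |x k μ - x l μ| ∧ |x k μ - x l μ| ≤ S) →
        |∫ U, ∏ k, (plaquetteObs r.ρ (x k) (o k).1 (o k).2 (torusLift (2 * S + 1) U) -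
              ∫ V, plaquetteObs r.ρ (x k) (o k).1 (o k).2 (torusLift (2 * S + 1) V)
                ∂(wilsonMeasure r.ρ β : Measure (GaugeConfig 4 (2 * S + 1) G)))
            ∂(wilsonMeasure r.ρ β : Measure (GaugeConfig 4 (2 * S + 1) G))| ≤
          ∏ k, (eLpNorm
            ((wilsonMeasure r.ρ β : Measure (GaugeConfig 4 (2 * S + 1) G))[fun U =>
                plaquetteObs r.ρ (x k) (o k).1 (o k).2 (torusLift (2 * S + 1) U) -
                  ∫ V, plaquetteObs r.ρ (x k) (o k).1 (o k).2 (torusLift (2 * S + 1) V)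
                    ∂(wilsonMeasure r.ρ β : Measure (GaugeConfig 4 (2 * S + 1) G)) |
              (cylinderEvents
                (torusEdge (2 * S + 1) ''
                  {e : Literature.MathematicalPhysics.QuantumLattice.ZdEdge 4 |
                    (∀ ν, |e.1 ν - (x k) ν| ≤ R) ∧
                    ∀ ν, |e.1 ν + (if ν = e.2 then 1 else 0) - (x k) ν| ≤ R})ᶜ :
                MeasurableSpace (GaugeConfig 4 (2 * S + 1) G))])
            (n : ℝ≥0∞) (wilsonMeasure r.ρ β : Measure (GaugeConfig 4 (2 * S + 1) G))).toReal) ∧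
    (∀ (G : Type) [Group G] [TopologicalSpace G] [IsTopologicalGroup G] [CompactSpace G]
        [MeasurableSpace G] [BorelSpace G] (r : LatticeRep G) (β : ℝ) (S : ℕ)
        (x : Literature.Probability.LatticeModels.Site 4) (i j : Fin 4)
        (p : ℝ≥0∞), 1 ≤ p → ∀ R R' : ℕ, R' ≤ R → 2 * R + 2 < 2 * S + 1 →
        (eLpNorm
          ((wilsonMeasure r.ρ β : Measure (GaugeConfig 4 (2 * S + 1) G))[fun U =>
              plaquetteObs r.ρ x i j (torusLift (2 * S + 1) U) -
                ∫ V, plaquetteObs r.ρ x i j (torusLift (2 * S + 1) V)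
                  ∂(wilsonMeasure r.ρ β : Measure (GaugeConfig 4 (2 * S + 1) G)) |
            (cylinderEvents
              (torusEdge (2 * S + 1) ''
                {e : Literature.MathematicalPhysics.QuantumLattice.ZdEdge 4 |
                  (∀ ν, |e.1 ν - x ν| ≤ R) ∧
                  ∀ ν, |e.1 ν + (if ν = e.2 then 1 else 0) - x ν| ≤ R})ᶜ :
              MeasurableSpace (GaugeConfig 4 (2 * S + 1) G))])
          p (wilsonMeasure r.ρ β : Measure (GaugeConfig 4 (2 * S + 1) G))).toReal ≤
        (eLpNorm
          ((wilsonMeasure r.ρ β : Measure (GaugeConfig 4 (2 * S + 1) G))[fun U =>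
              plaquetteObs r.ρ x i j (torusLift (2 * S + 1) U) -
                ∫ V, plaquetteObs r.ρ x i j (torusLift (2 * S + 1) V)
                  ∂(wilsonMeasure r.ρ β : Measure (GaugeConfig 4 (2 * S + 1) G)) |
            (cylinderEvents
              (torusEdge (2 * S + 1) ''
                {e : Literature.MathematicalPhysics.QuantumLattice.ZdEdge 4 |
                  (∀ ν, |e.1 ν - x ν| ≤ R') ∧
                  ∀ ν, |e.1 ν + (if ν = e.2 then 1 else 0) - x ν| ≤ R'})ᶜ :
              MeasurableSpace (GaugeConfig 4 (2 * S + 1) G))])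
          p (wilsonMeasure r.ρ β : Measure (GaugeConfig 4 (2 * S + 1) G))).toReal) := by
  intro hloc
  refine ⟨fun G _ _ _ _ _ _ r β S R n o x _ hRS hsep =>
      telescoping_core r β S R n o x (hloc G r β S R) hRS hsep,
    fun G _ _ _ _ _ _ r β S x i j p hp R R' hRR' _ => ?_⟩
  haveI : SecondCountableTopology G :=
    (r.continuous.isClosedEmbedding r.injective).isEmbedding.secondCountableTopology
  haveI := isProbabilityMeasure_wilsonMeasure (d := 4) (L := 2 * S + 1) r.ρ r.continuous β
  exact toReal_eLpNorm_condExp_mono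
    (cylinderEvents_mono (Set.compl_subset_compl.2 (Set.image_mono (linkCube_mono hRR' x))))
    cylinderEvents_le_pi
    (memLp_plaquetteObs_torusLift_sub_integral r.ρ r.continuous r.mem_unitary (2 * S + 1) x i j
      _ p) hp

end Summit.QuantumFields.YangMills.Cruxes.HypercubicLimit.ConditionalMeanTelescoping
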